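import Mathlib
import HarnessLib
import Summits.Ventures.LatticeQCDFlow.Scaling.EntropyLagLaw

/-!
# EntropyMarginalCloseness — every marginal of the switching protocol is close to its equilibrium
# law IN RELATIVE ENTROPY, `KL(μ_j ‖ π_j) ≤ (1−κ)(q̄ + (δ/λ)Λ)/(1 − (1−κ)(1 + δ/λ))`, hence in every
# bounded observable: `|E_{μ_j}O − ⟨O⟩_{c_j}| ≤ (KL(μ_j‖π_j) + Λ_O(λ'))/λ'` — the UNWEIGHTED
# end-point ensemble of a non-equilibrium evolution (the weights-dropped / X-3 arm) is certifiably
# near the target, with no sup-norm factor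

HONEST FRAMING: exact (Metropolis-corrected) sampling algorithms for lattice gauge theory;
figures of merit are autocorrelation/cost numbers at stated couplings and volumes; no
continuum-physics claim.

Venture `LatticeQCDFlow` (cell pub-lqcd), topic `Scaling`; FANOUT row 19 (`su2-snf`, GEN-9).  OUR
WORK; nothing is cited as a fact.  `Scaling/EntropyLagLaw` controls the SUM of the lags; the same
linear recursion controls EACH relative entropy `a_j = KL(μ_j ‖ π_j)` of the `j`-th marginal to the
`j`-th equilibrium law: with `a_0 = 0` and `a_{j+1} ≤ r·a_j + s_j` one has `a_j ≤ s̄/(1 − r)` for a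
uniform bound `s_j ≤ s̄`.  Combined with the Gibbs variational inequality for an arbitrary observable
this is the certified reading of row 19's P6 / GEN-8's `…DroppedWeightsBias`: how far the end-point
configurations of the protocol are from the target BEFORE reweighting.

## Content (setting of `Scaling/EntropyLagLaw`: uniform grid `c_{k+1} − c_k = δ`, row-stochastic
## layers with entropy contraction `κ`, log-MGF envelope `Λ ≥ 0` of `D` at `±λ`, `q̄ ≥ KL(π_j‖π_{j+1})`)

* `le_div_of_rec` — `a_0 = 0`, `0 ≤ s_j ≤ s̄`, `a_{j+1} ≤ r a_j + s_j`, `0 ≤ r < 1` ⇒ `a_j ≤ s̄/(1 − r)`;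
* **`klFin_evolveLaw_le_of_entropy`** — for every `j ≤ n`:
  `KL(μ_j ‖ π_j) ≤ (1 − κ)(q̄ + (δ/λ)Λ)/(1 − (1 − κ)(1 + δ/λ))`;
* **`abs_sum_evolveLaw_sub_gibbsMean_le`** — for every observable `O` and `λ' > 0` with
  `log Σ π_j e^{±λ'(O − ⟨O⟩_j)} ≤ Λ_O`: `|E_{μ_j} O − ⟨O⟩_{c_j}| ≤ (KL(μ_j ‖ π_j) + Λ_O)/λ'`;
* `klFin_evolveLaw_le_of_entropy'` — the choice `λ = 2δ(1−κ)/κ` (`κ < 1`):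
  `KL(μ_j ‖ π_j) ≤ 2(1−κ)·q̄/κ + Λ`.

Reading (value-free): with Hoeffding envelopes (`q̄, Λ ≤ (step·ΔD)²/8`-type, `Scaling/EntropyLagLawDoeblin`)
the end-point marginal satisfies `KL(μ_n ‖ π_target) = O(δ²ΔD²/κ²)` — POLYNOMIALLY small in `1/n` —
and every bounded observable of the unweighted end-point ensemble is within
`ΔO·√(KL/2)`-type distance of its target mean: an observable `z`-test cannot flag the weights-dropped
arm at production `n_step` (P6), now without the `χ²` route's `e^{ΔD/(2n)}`.  NOT CLAIMED: numbers.
-/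

namespace Summit.Ventures.LatticeQCDFlow.Scaling

open Finset
open Literature.Probability.MarkovChains (IsRowStochastic stepLaw stepLaw_nonneg sum_stepLaw)
open Summit.Ventures.LatticeQCDFlow.Exactness
open Summit.Ventures.LatticeQCDFlow.Theory2

variable {X : Type*} [Fintype X]

/-! ## §1 The pointwise consequence of the linear recursion -/

/-- `a_0 = 0`, `0 ≤ s_j ≤ s̄`, `a_{j+1} ≤ r·a_j + s_j` (`j < n`), `0 ≤ r < 1` ⇒ `a_j ≤ s̄/(1 − r)` for
`j ≤ n`. [ours] -/
theorem le_div_of_rec {a s : ℕ → ℝ} {r sbar : ℝ} (hr0 : 0 ≤ r) (hr1 : r < 1) (ha0 : a 0 = 0)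
    (hs : ∀ j, s j ≤ sbar) (hs0 : 0 ≤ sbar) (n : ℕ)
    (hrec : ∀ j, j < n → a (j + 1) ≤ r * a j + s j) :
    ∀ j, j ≤ n → a j ≤ sbar / (1 - r) := by
  have h1r : 0 < 1 - r := sub_pos.2 hr1
  have hfix : r * (sbar / (1 - r)) + sbar = sbar / (1 - r) := by
    field_simp
    ring
  intro j
  induction j with
  | zero => intro _; rw [ha0]; exact div_nonneg hs0 h1r.le
  | succ j ih =>
    intro hj
    have hj' : j < n := Nat.lt_of_succ_le hj
    calc a (j + 1) ≤ r * a j + s j := hrec j hj'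
      _ ≤ r * (sbar / (1 - r)) + sbar :=
          add_le_add (mul_le_mul_of_nonneg_left (ih hj'.le) hr0) (hs j)
      _ = sbar / (1 - r) := hfix

/-! ## §2 Every marginal is close to its equilibrium law -/

section Law

variable [Nonempty X] (S₀ D : X → ℝ) (c : ℕ → ℝ) (P : ℕ → X → X → ℝ)

/-- **RELATIVE ENTROPY OF THE `j`-TH MARGINAL TO THE `j`-TH EQUILIBRIUM LAW.**  Row-stochastic layers
with entropy contraction `0 < κ ≤ 1`, uniform grid `c_{k+1} − c_k = δ > 0`, a log-MGF envelope
`Λ ≥ 0` at `±λ` (`λ > 0`, `r = (1−κ)(1 + δ/λ) < 1`) and a quasi-static step bound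
`KL(π_j ‖ π_{j+1}) ≤ q̄` for the levels `j < n`.  Then for every `j ≤ n`:
`KL(μ_j ‖ π_j) ≤ (1 − κ)(q̄ + (δ/λ)Λ)/(1 − r)`. [ours] -/
theorem klFin_evolveLaw_le_of_entropy (hP : ∀ k, IsRowStochastic (P k)) {δ : ℝ} (hδ : 0 < δ)
    (hc : ∀ k, c (k + 1) - c k = δ) {κ : ℝ} (hκ1 : κ ≤ 1)
    (hK : ∀ k (μ : X → ℝ), (∀ x, 0 ≤ μ x) → ∑ x, μ x = 1 →
      klFin (stepLaw (P k) μ) (gibbsLaw (linAction S₀ D (c (k + 1))))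
        ≤ (1 - κ) * klFin μ (gibbsLaw (linAction S₀ D (c (k + 1)))))
    {lam Λ qbar : ℝ} (hlam : 0 < lam) (hΛ0 : 0 ≤ Λ) (hq0 : 0 ≤ qbar)
    (hr : (1 - κ) * (1 + δ / lam) < 1) (n : ℕ)
    (hΛp : ∀ j, j < n → Real.log (∑ y, gibbsLaw (linAction S₀ D (c j)) y
        * Real.exp (lam * (D y - meanD S₀ D (c j)))) ≤ Λ)
    (hΛm : ∀ j, j < n → Real.log (∑ y, gibbsLaw (linAction S₀ D (c j)) y
        * Real.exp (-lam * (D y - meanD S₀ D (c j)))) ≤ Λ)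
    (hq : ∀ j, j < n → klFin (gibbsLaw (linAction S₀ D (c j)))
        (gibbsLaw (linAction S₀ D (c (j + 1)))) ≤ qbar) :
    ∀ j, j ≤ n → klFin (evolveLaw P (gibbsLaw (linAction S₀ D (c 0))) j)
        (gibbsLaw (linAction S₀ D (c j)))
      ≤ (1 - κ) * (qbar + (δ / lam) * Λ) / (1 - (1 - κ) * (1 + δ / lam)) := by
  set a : ℕ → ℝ := fun j => klFin (evolveLaw P (gibbsLaw (linAction S₀ D (c 0))) j)
    (gibbsLaw (linAction S₀ D (c j))) with ha
  set u := δ / lam with hu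
  have hu0 : 0 < u := div_pos hδ hlam
  have hκ' : 0 ≤ 1 - κ := sub_nonneg.2 hκ1
  have han : ∀ j, 0 ≤ a j := fun j =>
    klFin_nonneg (evolveLaw_nonneg S₀ D c P hP j) (gibbsLaw_pos _)
      (by rw [sum_evolveLaw_gibbs S₀ D c P hP j, sum_gibbsLaw])
  have ha0 : a 0 = 0 := by
    simp only [ha, evolveLaw_zero]
    exact klFin_self (gibbsLaw_pos _)
  -- the step `s_j = (1−κ)(q_j + uΛ)` truncated to the levels `j < n`
  set s : ℕ → ℝ := fun j => if j < n then (1 - κ) * (klFin (gibbsLaw (linAction S₀ D (c j)))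
    (gibbsLaw (linAction S₀ D (c (j + 1)))) + u * Λ) else 0 with hs
  have hsb : ∀ j, s j ≤ (1 - κ) * (qbar + u * Λ) := by
    intro j
    simp only [hs]
    split_ifs with hj
    · exact mul_le_mul_of_nonneg_left (by linarith [hq j hj]) hκ'
    · exact mul_nonneg hκ' (by positivity)
  have hrec : ∀ j, j < n → a (j + 1) ≤ (1 - κ) * (1 + u) * a j + s j := by
    intro j hj
    have h1 := klFin_evolveLaw_succ_le S₀ D c P hP hc hK j
    have hlag := abs_layerLag_le_entropy S₀ D c P hP hlam j (hΛp j hj) (hΛm j hj)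
    have h2 : δ * layerLag S₀ D c P j ≤ u * (a j + Λ) := by
      have := (abs_le.1 hlag).2
      calc δ * layerLag S₀ D c P j ≤ δ * ((a j + Λ) / lam) :=
            mul_le_mul_of_nonneg_left this hδ.le
        _ = u * (a j + Λ) := by rw [hu]; ring
    simp only [hs, if_pos hj]
    calc a (j + 1) ≤ (1 - κ) * (a j + δ * layerLag S₀ D c P j
          + klFin (gibbsLaw (linAction S₀ D (c j))) (gibbsLaw (linAction S₀ D (c (j + 1))))) := h1
      _ ≤ (1 - κ) * (a j + u * (a j + Λ)
          + klFin (gibbsLaw (linAction S₀ D (c j))) (gibbsLaw (linAction S₀ D (c (j + 1))))) := by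
          apply mul_le_mul_of_nonneg_left _ hκ'
          linarith
      _ = (1 - κ) * (1 + u) * a j + (1 - κ) * (klFin (gibbsLaw (linAction S₀ D (c j)))
          (gibbsLaw (linAction S₀ D (c (j + 1)))) + u * Λ) := by ring
  have hr0 : 0 ≤ (1 - κ) * (1 + u) := mul_nonneg hκ' (by positivity)
  exact le_div_of_rec hr0 hr ha0 hsb (mul_nonneg hκ' (by positivity)) n hrec

/-- **EVERY MARGINAL IS OBSERVABLY CLOSE TO EQUILIBRIUM**: for any observable `O`, any `λ' > 0`
and `Λ_O` bounding `log Σ_y π_j(y) e^{±λ'(O y − ⟨O⟩_{c_j})}`: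
`|E_{μ_j} O − ⟨O⟩_{c_j}| ≤ (KL(μ_j ‖ π_j) + Λ_O)/λ'` (the Gibbs variational inequality). [ours] -/
theorem abs_sum_evolveLaw_sub_gibbsMean_le (hP : ∀ k, IsRowStochastic (P k)) (O : X → ℝ)
    {lam' ΛO : ℝ} (hlam : 0 < lam') (j : ℕ)
    (hΛp : Real.log (∑ y, gibbsLaw (linAction S₀ D (c j)) y
        * Real.exp (lam' * (O y - gibbsMean (linAction S₀ D (c j)) O))) ≤ ΛO)
    (hΛm : Real.log (∑ y, gibbsLaw (linAction S₀ D (c j)) y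
        * Real.exp (-lam' * (O y - gibbsMean (linAction S₀ D (c j)) O))) ≤ ΛO) :
    |∑ y, evolveLaw P (gibbsLaw (linAction S₀ D (c 0))) j y * O y
        - gibbsMean (linAction S₀ D (c j)) O|
      ≤ (klFin (evolveLaw P (gibbsLaw (linAction S₀ D (c 0))) j) (gibbsLaw (linAction S₀ D (c j)))
          + ΛO) / lam' := by
  have hμ0 := evolveLaw_nonneg S₀ D c P hP j
  have hμ1 := sum_evolveLaw_gibbs S₀ D c P hP j
  have hπ0 : ∀ x, 0 < gibbsLaw (linAction S₀ D (c j)) x := gibbsLaw_pos _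
  have hlin : ∀ t : ℝ, ∑ x, evolveLaw P (gibbsLaw (linAction S₀ D (c 0))) j x
      * (t * (O x - gibbsMean (linAction S₀ D (c j)) O))
        = t * (∑ y, evolveLaw P (gibbsLaw (linAction S₀ D (c 0))) j y * O y
          - gibbsMean (linAction S₀ D (c j)) O) := by
    intro t
    have hx : ∀ x, evolveLaw P (gibbsLaw (linAction S₀ D (c 0))) j x
        * (t * (O x - gibbsMean (linAction S₀ D (c j)) O))
        = t * (evolveLaw P (gibbsLaw (linAction S₀ D (c 0))) j x * O x)
          - (t * gibbsMean (linAction S₀ D (c j)) O)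
            * evolveLaw P (gibbsLaw (linAction S₀ D (c 0))) j x := by
      intro x; ring
    rw [sum_congr rfl (fun x _ => hx x), sum_sub_distrib, ← mul_sum, ← mul_sum, hμ1]
    ring
  have hp := sum_mul_le_klFin_add_log hμ0 hμ1 hπ0
    (fun x => lam' * (O x - gibbsMean (linAction S₀ D (c j)) O))
  have hm := sum_mul_le_klFin_add_log hμ0 hμ1 hπ0
    (fun x => -lam' * (O x - gibbsMean (linAction S₀ D (c j)) O))
  rw [hlin] at hp hm
  rw [abs_le]
  constructor
  · rw [neg_le, le_div_iff₀ hlam]; linarith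
  · rw [le_div_iff₀ hlam]; linarith

/-- **The choice `λ = 2δ(1−κ)/κ`** (`0 < κ < 1`): `KL(μ_j ‖ π_j) ≤ 2(1 − κ)·q̄/κ + Λ` for every
`j ≤ n`, `Λ` the envelope at `±2δ(1−κ)/κ`. [ours] -/
theorem klFin_evolveLaw_le_of_entropy' (hP : ∀ k, IsRowStochastic (P k)) {δ : ℝ} (hδ : 0 < δ)
    (hc : ∀ k, c (k + 1) - c k = δ) {κ : ℝ} (hκ0 : 0 < κ) (hκ1 : κ < 1)
    (hK : ∀ k (μ : X → ℝ), (∀ x, 0 ≤ μ x) → ∑ x, μ x = 1 →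
      klFin (stepLaw (P k) μ) (gibbsLaw (linAction S₀ D (c (k + 1))))
        ≤ (1 - κ) * klFin μ (gibbsLaw (linAction S₀ D (c (k + 1)))))
    {Λ qbar : ℝ} (hΛ0 : 0 ≤ Λ) (hq0 : 0 ≤ qbar) (n : ℕ)
    (hΛp : ∀ j, j < n → Real.log (∑ y, gibbsLaw (linAction S₀ D (c j)) y
        * Real.exp ((2 * δ * (1 - κ) / κ) * (D y - meanD S₀ D (c j)))) ≤ Λ)
    (hΛm : ∀ j, j < n → Real.log (∑ y, gibbsLaw (linAction S₀ D (c j)) y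
        * Real.exp (-(2 * δ * (1 - κ) / κ) * (D y - meanD S₀ D (c j)))) ≤ Λ)
    (hq : ∀ j, j < n → klFin (gibbsLaw (linAction S₀ D (c j)))
        (gibbsLaw (linAction S₀ D (c (j + 1)))) ≤ qbar) :
    ∀ j, j ≤ n → klFin (evolveLaw P (gibbsLaw (linAction S₀ D (c 0))) j)
        (gibbsLaw (linAction S₀ D (c j))) ≤ 2 * (1 - κ) * qbar / κ + Λ := by
  have h1κ : 0 < 1 - κ := sub_pos.2 hκ1
  have hlam : 0 < 2 * δ * (1 - κ) / κ := div_pos (by positivity) hκ0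
  have hu : δ / (2 * δ * (1 - κ) / κ) = κ / (2 * (1 - κ)) := by field_simp
  have hr : (1 - κ) * (1 + δ / (2 * δ * (1 - κ) / κ)) < 1 := by
    rw [hu]
    have : (1 - κ) * (1 + κ / (2 * (1 - κ))) = 1 - κ / 2 := by field_simp; ring
    rw [this]; linarith
  intro j hj
  have key := klFin_evolveLaw_le_of_entropy S₀ D c P hP hδ hc hκ1.le hK hlam hΛ0 hq0 hr n hΛp hΛm
    hq j hj
  rw [hu] at key
  have hden : 1 - (1 - κ) * (1 + κ / (2 * (1 - κ))) = κ / 2 := by field_simp; ring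
  rw [hden] at key
  refine key.trans (le_of_eq ?_)
  field_simp

end Law

end Summit.Ventures.LatticeQCDFlow.Scaling
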